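import Summits.QuantumFields.YangMills.Theorems.BalabanLadderIRColdPurityBridge
import Literature.MathematicalPhysics.QuantumFieldTheory.WilsonFinTorusTwistedPartitionDomination
import HarnessLib

/-!
# Line «twisted-slab-continuity» (crux `IRcof`, stmt-QuantumFields-26930) — the endpoint SEAM as tree theorems:
# `seam_arith` and the domination seam «flux regime at `t` ∧ projected twisted purity ⇒ the PERIODIC cold box is `1/24`-pure»

Helper for `Summit.QuantumFields.YangMills.Theses.BalabanLadder.IRcof` (stmt-QuantumFields-26930), wave-2 line «twisted-slab-continuity»
(ideator ym-ir-idea-20 g0, lens `resurrect`; workfile `Cruxes/IRcof/Lines/twisted_slab_continuity.lean` 095381460304, card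
`Cruxes/IRcof/Lines/twisted-slab-continuity.md`; critic ym-ir-crit-3 g3 2026-08-28T17:20:39Z PASS-WITH-PRICE (B-grade): «`seam_arith` + domination
seam landable as helper»; director-ym №34 17:27:22Z: helpers keyed to pool-p3, row 43 first).  Everything here is PROVED; no definition, no
named fact, no stub of the line is touched (T1 `TwistedSlabAnchor` has its own LEAD seat ym-ir-line-tsc-p1; T2 ∕ T3 ∕ residual ∕ N_cof open).

* `seam_arith` — VERBATIM the workfile's arithmetic of the seam: `(95/96)·Zt ≤ P`, `P₂ ≤ Z₂`, `1 − P₂/P² ≤ 1/96`, `Zt > 0` ⟹ `1 − Z₂/Zt² ≤ 1/24`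
  (indeed `≤ 1 − (95/96)³ = 0.0309…`).
* `avg_le`, `le_avg` — averages over `Fin n` of bounded families (the workfile's private plumbing, public here).
* `coldDefect_le_of_fluxRegime_projectedPurity` — **the domination seam, def-free and for an ARBITRARY finite family of central twist
  tensors** (the workfile instantiates it with the `e₂`-flux projection `k ↦ slabTwist z (z^k)`): on the cold box `L³ × ⌊L/4⌋` (`L ≥ 8`,
  `β ≥ 0`), if every member `W_{τ_k}` of a nonempty family of tensor-twisted Wilson partition functions is in 't Hooft's regime at `t = ⌊L/4⌋`
  (`(1 − 1/96)·Z ≤ W_{τ_k}`) and the family AVERAGE is `1/96`-pure under period doubling (`1 − avg W(2t) / (avg W(t))² ≤ 1/96`), then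
  `coldDefect ρ β L ≤ 1/24` — because every `W_{τ_k}(2t) ≤ Z(2t)` by the tree's twist DOMINATION
  `wilsonFinTorusTensorTwistedPartition_le_partition` (`WilsonFinTorusTwistedPartitionDomination.lean`).
  `coldDefect_le_of_fluxRegime_twistedPurity` is the one-tensor case.

HONEST FRAMING: bookkeeping between typed finite-box quantities; width toward PXcof ∕ `IRcof` ∕ `IR`: 0; the line's content sits in its
stubs; nothing here proves the Yang–Mills mass gap (Clay) — NOT proved; R4 closes only the conditional finite-𝕋⁴ rung `BalabanLadder.UV`.
-/

set_option autoImplicit false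

noncomputable section

open MeasureTheory Finset
open scoped BigOperators
open Literature.MathematicalPhysics.QuantumFieldTheory Literature.MathematicalPhysics.QuantumLattice
open Summit.QuantumFields.YangMills.Cruxes.IR.ColdPurityBridge (coldDefect)

namespace Summit.QuantumFields.YangMills.Cruxes.IRcof.TwistedSlabContinuity

/-! ## §1 Averages over `Fin n` (plumbing) -/

/-- An average of terms `≤ b` is `≤ b`. -/
theorem avg_le {n : ℕ} (hn : 0 < n) (f : Fin n → ℝ) (b : ℝ) (h : ∀ k, f k ≤ b) :
    (n : ℝ)⁻¹ * ∑ k, f k ≤ b := by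
  have hs : ∑ k, f k ≤ ∑ _k : Fin n, b := Finset.sum_le_sum fun k _ => h k
  simp only [Finset.sum_const, Finset.card_univ, Fintype.card_fin, nsmul_eq_mul] at hs
  have hn' : (0 : ℝ) < n := by exact_mod_cast hn
  rw [inv_mul_le_iff₀ hn']
  exact hs

/-- An average of terms `≥ b` is `≥ b`. -/
theorem le_avg {n : ℕ} (hn : 0 < n) (f : Fin n → ℝ) (b : ℝ) (h : ∀ k, b ≤ f k) :
    b ≤ (n : ℝ)⁻¹ * ∑ k, f k := by
  have hs : ∑ _k : Fin n, b ≤ ∑ k, f k := Finset.sum_le_sum fun k _ => h k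
  simp only [Finset.sum_const, Finset.card_univ, Fintype.card_fin, nsmul_eq_mul] at hs
  have hn' : (0 : ℝ) < n := by exact_mod_cast hn
  rw [le_inv_mul_iff₀ hn']
  exact hs

/-! ## §2 The arithmetic of the seam (VERBATIM the workfile's `seam_arith`) -/

/-- **The arithmetic of the seam.**  If `P ≥ (95/96)·Zt > 0` (flux regime, averaged), `P₂ ≤ Z₂` (domination, averaged) and
`1 − P₂/P² ≤ 1/96` (projected twisted purity), then `1 − Z₂/Zt² ≤ 1/24` (indeed `≤ 1 − (95/96)³`). -/
theorem seam_arith {Zt Z2 P P2 : ℝ} (hZt : 0 < Zt) (hP : (1 - 1 / 96) * Zt ≤ P) (hP2 : P2 ≤ Z2)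
    (hpure : 1 - P2 / P ^ 2 ≤ 1 / 96) : 1 - Z2 / Zt ^ 2 ≤ 1 / 24 := by
  have hPpos : 0 < P := lt_of_lt_of_le (by positivity) hP
  have hP2sq : 0 < P ^ 2 := by positivity
  have h1 : (1 - 1 / 96) * P ^ 2 ≤ P2 := by
    have := hpure
    rw [sub_le_iff_le_add] at this
    have h' : 1 - 1 / 96 ≤ P2 / P ^ 2 := by linarith
    rwa [le_div_iff₀ hP2sq] at h'
  have h2 : (1 - 1 / 96) ^ 2 * Zt ^ 2 ≤ P ^ 2 := by
    have h0 : 0 ≤ (1 - 1 / 96) * Zt := by positivity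
    nlinarith [hP, h0]
  have h3 : (1 - 1 / 96) ^ 3 * Zt ^ 2 ≤ Z2 := by nlinarith [h1, h2, hP2]
  have hZt2 : 0 < Zt ^ 2 := by positivity
  have h4 : (1 - 1 / 96) ^ 3 ≤ Z2 / Zt ^ 2 := by
    rw [le_div_iff₀ hZt2]; exact h3
  nlinarith [h4]

/-- The sharp form of the same arithmetic: the conclusion is `1 − Z₂/Zt² ≤ 1 − (95/96)³` (`= 0.0309… < 1/24`). -/
theorem seam_arith_sharp {Zt Z2 P P2 : ℝ} (hZt : 0 < Zt) (hP : (1 - 1 / 96) * Zt ≤ P) (hP2 : P2 ≤ Z2)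
    (hpure : 1 - P2 / P ^ 2 ≤ 1 / 96) : 1 - Z2 / Zt ^ 2 ≤ 1 - (1 - 1 / 96) ^ 3 := by
  have hPpos : 0 < P := lt_of_lt_of_le (by positivity) hP
  have hP2sq : 0 < P ^ 2 := by positivity
  have h1 : (1 - 1 / 96) * P ^ 2 ≤ P2 := by
    have h' : 1 - 1 / 96 ≤ P2 / P ^ 2 := by linarith
    rwa [le_div_iff₀ hP2sq] at h'
  have h2 : (1 - 1 / 96) ^ 2 * Zt ^ 2 ≤ P ^ 2 := by
    have h0 : 0 ≤ (1 - 1 / 96) * Zt := by positivity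
    nlinarith [hP, h0]
  have h3 : (1 - 1 / 96) ^ 3 * Zt ^ 2 ≤ Z2 := by nlinarith [h1, h2, hP2]
  have hZt2 : 0 < Zt ^ 2 := by positivity
  have h4 : (1 - 1 / 96) ^ 3 ≤ Z2 / Zt ^ 2 := by
    rw [le_div_iff₀ hZt2]; exact h3
  linarith

/-! ## §3 The domination seam for an arbitrary finite family of central twist tensors -/

section Domination

variable {G : Type} [Group G] [TopologicalSpace G] [IsTopologicalGroup G] [CompactSpace G]
  [MeasurableSpace G] [BorelSpace G] [SecondCountableTopology G] {N : ℕ}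

/-- **The domination seam (family form).**  Cold box `L³ × ⌊L/4⌋`, `L ≥ 8`, `β ≥ 0`, a continuous unitary `ρ`, and a nonempty finite family
`τ : Fin n → (Fin 4 → Fin 4 → G)` of twist tensors whose read entries (`μ < ν`) are central.  If (flux regime at `t = ⌊L/4⌋`) every
`W_{τ_k}(L,L,L,⌊L/4⌋) ≥ (1 − 1/96)·Z(L,L,L,⌊L/4⌋)` and (projected purity) `1 − avg_k W_{τ_k}(2⌊L/4⌋) / (avg_k W_{τ_k}(⌊L/4⌋))² ≤ 1/96`, then
`coldDefect ρ β L ≤ 1/24`.  The only input is the tree's twist domination `W_τ ≤ Z` at `2⌊L/4⌋`. -/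
theorem coldDefect_le_of_fluxRegime_projectedPurity (ρ : G →* Matrix (Fin N) (Fin N) ℂ) (hρ : Continuous ρ)
    (hρu : ∀ g, ρ g ∈ Matrix.unitaryGroup (Fin N) ℂ) {β : ℝ} (hβ : 0 ≤ β) {L : ℕ} (hL : 8 ≤ L)
    {n : ℕ} (hn : 0 < n) (τ : Fin n → Fin 4 → Fin 4 → G) (hτ : ∀ k : Fin n, ∀ μ ν : Fin 4, μ < ν → τ k μ ν ∈ Subgroup.center G)
    (hflux : ∀ k : Fin n, (1 - 1 / 96) * wilsonFinTorusPartition ρ β L L L (L / 4) ≤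
      wilsonFinTorusTensorTwistedPartition ρ β (τ k) L L L (L / 4))
    (hpure : 1 - ((n : ℝ)⁻¹ * ∑ k : Fin n, wilsonFinTorusTensorTwistedPartition ρ β (τ k) L L L (2 * (L / 4))) /
      ((n : ℝ)⁻¹ * ∑ k : Fin n, wilsonFinTorusTensorTwistedPartition ρ β (τ k) L L L (L / 4)) ^ 2 ≤ 1 / 96) :
    coldDefect ρ β L ≤ 1 / 24 := by
  have hL2 : 2 ≤ L := by omega
  have h2t : 2 ≤ 2 * (L / 4) := by omega
  have hdom : ∀ k : Fin n, wilsonFinTorusTensorTwistedPartition ρ β (τ k) L L L (2 * (L / 4)) ≤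
      wilsonFinTorusPartition ρ β L L L (2 * (L / 4)) := fun k =>
    wilsonFinTorusTensorTwistedPartition_le_partition ρ hρ hρu hβ (hτ k) hL2 hL2 h2t
  have hP : (1 - 1 / 96) * wilsonFinTorusPartition ρ β L L L (L / 4) ≤
      (n : ℝ)⁻¹ * ∑ k : Fin n, wilsonFinTorusTensorTwistedPartition ρ β (τ k) L L L (L / 4) := le_avg hn _ _ hflux
  have hP2 : (n : ℝ)⁻¹ * ∑ k : Fin n, wilsonFinTorusTensorTwistedPartition ρ β (τ k) L L L (2 * (L / 4)) ≤
      wilsonFinTorusPartition ρ β L L L (2 * (L / 4)) := avg_le hn _ _ hdom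
  have hZt : 0 < wilsonFinTorusPartition ρ β L L L (L / 4) := wilsonFinTorusPartition_pos (ρ := ρ) hρ β L L L _
  unfold coldDefect
  exact seam_arith hZt hP hP2 hpure

/-- **The domination seam, one tensor.**  If ONE centrally twisted box `W_τ` is in the flux regime at `⌊L/4⌋` and `1/96`-pure under period
doubling, the periodic cold box is `1/24`-pure. -/
theorem coldDefect_le_of_fluxRegime_twistedPurity (ρ : G →* Matrix (Fin N) (Fin N) ℂ) (hρ : Continuous ρ)
    (hρu : ∀ g, ρ g ∈ Matrix.unitaryGroup (Fin N) ℂ) {β : ℝ} (hβ : 0 ≤ β) {L : ℕ} (hL : 8 ≤ L)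
    (τ : Fin 4 → Fin 4 → G) (hτ : ∀ μ ν : Fin 4, μ < ν → τ μ ν ∈ Subgroup.center G)
    (hflux : (1 - 1 / 96) * wilsonFinTorusPartition ρ β L L L (L / 4) ≤ wilsonFinTorusTensorTwistedPartition ρ β τ L L L (L / 4))
    (hpure : 1 - wilsonFinTorusTensorTwistedPartition ρ β τ L L L (2 * (L / 4)) /
      wilsonFinTorusTensorTwistedPartition ρ β τ L L L (L / 4) ^ 2 ≤ 1 / 96) :
    coldDefect ρ β L ≤ 1 / 24 := by
  refine coldDefect_le_of_fluxRegime_projectedPurity ρ hρ hρu hβ hL Nat.one_pos (fun _ => τ) (fun _ => hτ) (fun _ => hflux) ?_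
  simpa using hpure

/-- The same seam for a `LatticeRep` (continuity and unitarity discharged). -/
theorem coldDefect_le_of_fluxRegime_projectedPurity_rep (r : LatticeRep G) {β : ℝ} (hβ : 0 ≤ β) {L : ℕ} (hL : 8 ≤ L)
    {n : ℕ} (hn : 0 < n) (τ : Fin n → Fin 4 → Fin 4 → G) (hτ : ∀ k : Fin n, ∀ μ ν : Fin 4, μ < ν → τ k μ ν ∈ Subgroup.center G)
    (hflux : ∀ k : Fin n, (1 - 1 / 96) * wilsonFinTorusPartition r.ρ β L L L (L / 4) ≤
      wilsonFinTorusTensorTwistedPartition r.ρ β (τ k) L L L (L / 4))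
    (hpure : 1 - ((n : ℝ)⁻¹ * ∑ k : Fin n, wilsonFinTorusTensorTwistedPartition r.ρ β (τ k) L L L (2 * (L / 4))) /
      ((n : ℝ)⁻¹ * ∑ k : Fin n, wilsonFinTorusTensorTwistedPartition r.ρ β (τ k) L L L (L / 4)) ^ 2 ≤ 1 / 96) :
    coldDefect r.ρ β L ≤ 1 / 24 :=
  coldDefect_le_of_fluxRegime_projectedPurity r.ρ r.continuous r.mem_unitary hβ hL hn τ hτ hflux hpure

end Domination

end Summit.QuantumFields.YangMills.Cruxes.IRcof.TwistedSlabContinuity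

end
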